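import Summits.AnomalousDissipation.AnomalousDissipation.Theses.EnsembleRigidity
import Literature.Analysis.FluidPDE.GalerkinFlow
import Literature.Analysis.FluidPDE.OnsagerBDSVGluing

/-!
# Sketch — crux idea `ergodic-selection-liminf-ceiling` for crux `GPMeanBoundedFamily`
(stmt-AnomalousDissipation-15509, route EnsembleRigidity), ideator k = 2, round 1.

First lemma (`CalmGalerkinOrbitsRealise`, ν FIXED, any admissible force): a Krylov–Bogoliubov /
Birkhoff selection on the Galerkin trajectory space turns CALM-IN-LIMINF Galerkin orbits of
unbounded order into ONE global Leray–Hopf solution with an `H`-valued lift whose limsup-Cesàro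
energy `meanEnergy` is `≤ E` (limsup = lim by Birkhoff).  Transfer target (`GPCalmGalerkinFamily`):
the crux with `meanEnergy (u j) ≤ E` replaced by the liminf-Cesàro energy of a Galerkin orbit at
each `ν j`.  `gpMeanBoundedFamily_of_calm` is the exact (sorry-free) glue
`CalmGalerkinOrbitsRealise → GPCalmGalerkinFamily → GPMeanBoundedFamily`.
-/

noncomputable section

open MeasureTheory Filter Topology Set
open Literature.Analysis.FunctionSpaces Literature.Analysis.FluidPDE

set_option linter.dupNamespace false

namespace Summit.AnomalousDissipation.AnomalousDissipation.Cruxes.GPMeanBoundedFamily.ErgodicSelection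

local notation "𝕋³" => UnitAddTorus (Fin 3)
local notation "E³" => EuclideanSpace ℝ (Fin 3)

/-- **First lemma (ν fixed): calm Galerkin orbits are realised by a limsup-calm Leray–Hopf path.**
For `ν > 0`, an admissible steady force `f` and a level `E`: if at infinitely many Galerkin orders
`N` some mean-zero Galerkin datum `a` has an orbit whose LIMINF of Cesàro mean energies is `≤ E`,
then there is a global Leray–Hopf solution `u` of NS_ν(f) with an `H`-valued lift (zero momentum,
weakly solenoidal slices) and `meanEnergy u ≤ E` (limsup of Cesàro means).  Proof route (all
pieces landed on the hub, route MomentParity): level-`N` Krylov–Bogoliubov along liminf-realising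
times (`∫ energy ≤ E`, l.s.c.), `exists_shiftInvariant_limit` on `pathSpace`, Birkhoff
(`Literature.Dynamics.Ergodic.birkhoff_ergodic_theorem_holds`) giving a support point with Birkhoff
energy limit `e ≤ E`, `stub_realisation` (Leray–Hopf realisation after a shift to an a.e. strong
time), `tendsto_timeMean_comp_add`. -/
def CalmGalerkinOrbitsRealise : Prop :=
  ∀ (ν E : ℝ) (f : 𝕋³ → E³), 0 < ν → Torus.IsSmooth f → Torus.IsDivFree f → Torus.HasZeroMean f →
    (∀ N₀ : ℕ, ∃ N : ℕ, N₀ ≤ N ∧ ∃ a : 𝕋³ → E³, IsGalerkinMode N a ∧ Torus.HasZeroMean a ∧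
        longTimeAvgInf (fun t => ∫ x, ‖Torus.galerkinFlow ν f N t a x‖ ^ 2) ≤ E) →
    ∃ (u₀ : 𝕋³ → E³) (u : ℝ → 𝕋³ → E³) (U : ℝ → Torus.energySpace (Fin 3)),
      Torus.IsGlobalLerayHopf ν (fun _ => f) u₀ u ∧
      (∀ t, 0 ≤ t → ((U t : Lp E³ 2 (volume : Measure 𝕋³)) : 𝕋³ → E³) =ᵐ[volume] u t) ∧
      meanEnergy u ≤ E

/-- **Variant on Leray–Hopf paths (Foias–Rosa–Temam 2015 form).** One lifted global Leray–Hopf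
solution with liminf-Cesàro energy `≤ E` yields one with limsup-Cesàro energy `≤ E` (Krylov–
Bogoliubov on the Vishik–Fursikov trajectory space of Leray–Hopf solutions + Birkhoff + restart at
an a.e. strong time).  Recorded as the LH-level statement of the same lever; the Galerkin form
above is the one the tree can prove now. -/
def CalmLerayHopfRealise : Prop :=
  ∀ (ν E : ℝ) (f u₀ : 𝕋³ → E³) (u : ℝ → 𝕋³ → E³) (U : ℝ → Torus.energySpace (Fin 3)),
    0 < ν → Torus.IsSmooth f → Torus.IsDivFree f → Torus.HasZeroMean f →
    Torus.IsGlobalLerayHopf ν (fun _ => f) u₀ u →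
    (∀ t, 0 ≤ t → ((U t : Lp E³ 2 (volume : Measure 𝕋³)) : 𝕋³ → E³) =ᵐ[volume] u t) →
    longTimeAvgInf (fun t => ∫ x, ‖u t x‖ ^ 2) ≤ E →
    ∃ (u₀' : 𝕋³ → E³) (u' : ℝ → 𝕋³ → E³) (U' : ℝ → Torus.energySpace (Fin 3)),
      Torus.IsGlobalLerayHopf ν (fun _ => f) u₀' u' ∧
      (∀ t, 0 ≤ t → ((U' t : Lp E³ 2 (volume : Measure 𝕋³)) : 𝕋³ → E³) =ᵐ[volume] u' t) ∧
      meanEnergy u' ≤ E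

/-- **Transfer target C⁺ (`GPCalmGalerkinFamily`)**: the crux with the limsup-mean energy of a
Leray–Hopf path replaced by the LIMINF-mean energy of a Galerkin orbit (levels unbounded) at each
viscosity — "NS_{ν_j}(f_GP) is not universally statistically fat": equivalently
`sup_j E_min(ν_j) < ∞` for the minimal mean energy over shift-invariant laws of the trajectory
space. -/
def GPCalmGalerkinFamily : Prop :=
  ∀ f : 𝕋³ → E³, f = (fun x : 𝕋³ =>
      (Torus.stokesMode (Pi.single (2 : Fin 3) (1 : ℤ)) (EuclideanSpace.single (0 : Fin 3) (1 : ℝ)) false x +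
        Torus.stokesMode (Pi.single (0 : Fin 3) (1 : ℤ)) (EuclideanSpace.single (1 : Fin 3) (1 : ℝ)) false x +
        Torus.stokesMode (Pi.single (1 : Fin 3) (1 : ℤ)) (EuclideanSpace.single (2 : Fin 3) (1 : ℝ)) false x : E³)) →
    ∃ (E : ℝ) (ν : ℕ → ℝ), (∀ j, 0 < ν j ∧ ν j ≤ 1) ∧ Tendsto ν atTop (𝓝 0) ∧
      ∀ j : ℕ, ∀ N₀ : ℕ, ∃ N : ℕ, N₀ ≤ N ∧ ∃ a : 𝕋³ → E³, IsGalerkinMode N a ∧ Torus.HasZeroMean a ∧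
        longTimeAvgInf (fun t => ∫ x, ‖Torus.galerkinFlow (ν j) f N t a x‖ ^ 2) ≤ E

/-- **Exact glue**: the first lemma and the calm-Galerkin family give the crux verbatim. -/
theorem gpMeanBoundedFamily_of_calm (hR : CalmGalerkinOrbitsRealise) (hC : GPCalmGalerkinFamily) :
    Summit.AnomalousDissipation.AnomalousDissipation.Theses.EnsembleRigidity.GPMeanBoundedFamily := by
  intro f hf
  obtain ⟨E, ν, hν, hν0, hcalm⟩ := hC f hf
  obtain ⟨hsm, hdf, hzm⟩ :
      Torus.IsSmooth f ∧ Torus.IsDivFree f ∧ Torus.HasZeroMean f := by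
    rw [hf]
    exact Summit.AnomalousDissipation.AnomalousDissipation.Theorems.SteadyStatesLoudBounded.GpAdmissible.stub_gpAdmissible
  have key : ∀ j, ∃ (u₀ : 𝕋³ → E³) (u : ℝ → 𝕋³ → E³) (U : ℝ → Torus.energySpace (Fin 3)),
      Torus.IsGlobalLerayHopf (ν j) (fun _ => f) u₀ u ∧
      (∀ t, 0 ≤ t → ((U t : Lp E³ 2 (volume : Measure 𝕋³)) : 𝕋³ → E³) =ᵐ[volume] u t) ∧
      meanEnergy u ≤ E := fun j =>
    hR (ν j) E f (hν j).1 hsm hdf hzm (hcalm j)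
  choose u₀ u U hLH hU hE using key
  exact ⟨E, ν, u₀, u, U, hν, hν0, hLH, fun j t ht => hU j t ht, hE⟩


/-! ## Card `parity-closes-beltrami-rays` — first lemmas (parity class of f_GP) -/

/-- **No odd Beltrami field (Galerkin / trigonometric-polynomial level).** A real vector trigonometric
polynomial on `T³` that is ODD under the point reflection (`v (-x) = - v x`) and is a `curl`
eigenfield with a non-zero eigenvalue vanishes identically.  (Fourier: oddness makes every
coefficient purely imaginary, `ĉ(k) = i w_k` with `w_k` real, and `2π k × w_k = λ' w_k` for a REAL
vector forces `w_k ⊥ w_k`.)  Consequence: the hot steady branches `h±/(4π²ν) + O(ν)` of NS_ν(f_GP)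
(TRIAGE-r1-1 §N1 of crux EnsembleCeiling) and every Beltrami big-dodger `A·ABC` lie outside the
odd class. -/
def NoOddBeltramiTrigPoly : Prop :=
  ∀ (S : Finset (Fin 3 → ℤ)) (c : (Fin 3 → ℤ) → EuclideanSpace ℂ (Fin 3)) (lam : ℝ),
    lam ≠ 0 →
    (∀ x : 𝕋³, Torus.realTrigPoly S c (-x) = - Torus.realTrigPoly S c x) →
    (∀ x : 𝕋³, Literature.Analysis.FluidPDE.BDSV.curl (Torus.realTrigPoly S c) x =
        lam • Torus.realTrigPoly S c x) →
    ∀ x : 𝕋³, Torus.realTrigPoly S c x = 0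

/-- **The odd class is invariant under the Galerkin dynamics of an odd force** (f_GP is odd: three
sines).  Uniqueness of the Galerkin ODE plus equivariance of `P_N B(·,·)` and of the Stokes operator
under `u ↦ -u(-·)`. -/
def OddInvariantGalerkinFlow : Prop :=
  ∀ (ν : ℝ) (f a : 𝕋³ → E³) (N : ℕ) (t : ℝ), 0 ≤ ν → 0 ≤ t →
    Torus.IsSmooth f → (∀ x, f (-x) = - f x) → IsGalerkinMode N a → (∀ x, a (-x) = - a x) →
    ∀ x, Torus.galerkinFlow ν f N t a (-x) = - Torus.galerkinFlow ν f N t a x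

/-- **Transfer target of the parity card**: calm Galerkin orbits from ODD data (zero momentum and
zero helicity automatic, no Beltrami content possible). -/
def GPCalmOddGalerkinFamily : Prop :=
  ∀ f : 𝕋³ → E³, f = (fun x : 𝕋³ =>
      (Torus.stokesMode (Pi.single (2 : Fin 3) (1 : ℤ)) (EuclideanSpace.single (0 : Fin 3) (1 : ℝ)) false x +
        Torus.stokesMode (Pi.single (0 : Fin 3) (1 : ℤ)) (EuclideanSpace.single (1 : Fin 3) (1 : ℝ)) false x +
        Torus.stokesMode (Pi.single (1 : Fin 3) (1 : ℤ)) (EuclideanSpace.single (2 : Fin 3) (1 : ℝ)) false x : E³)) →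
    ∃ (E : ℝ) (ν : ℕ → ℝ), (∀ j, 0 < ν j ∧ ν j ≤ 1) ∧ Tendsto ν atTop (𝓝 0) ∧
      ∀ j : ℕ, ∀ N₀ : ℕ, ∃ N : ℕ, N₀ ≤ N ∧ ∃ a : 𝕋³ → E³, IsGalerkinMode N a ∧ (∀ x, a (-x) = - a x) ∧
        Torus.HasZeroMean a ∧
        longTimeAvgInf (fun t => ∫ x, ‖Torus.galerkinFlow (ν j) f N t a x‖ ^ 2) ≤ E

/-- Odd calm orbits are calm orbits. -/
theorem gpCalmGalerkinFamily_of_odd (h : GPCalmOddGalerkinFamily) : GPCalmGalerkinFamily := by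
  intro f hf
  obtain ⟨E, ν, hν, hν0, hcalm⟩ := h f hf
  refine ⟨E, ν, hν, hν0, fun j N₀ => ?_⟩
  obtain ⟨N, hN, a, ha, -, hz, hE⟩ := hcalm j N₀
  exact ⟨N, hN, a, ha, hz, hE⟩

/-- Hence the parity card also reaches the crux verbatim through the realisation lemma. -/
theorem gpMeanBoundedFamily_of_odd_calm (hR : CalmGalerkinOrbitsRealise) (h : GPCalmOddGalerkinFamily) :
    Summit.AnomalousDissipation.AnomalousDissipation.Theses.EnsembleRigidity.GPMeanBoundedFamily :=
  gpMeanBoundedFamily_of_calm hR (gpCalmGalerkinFamily_of_odd h)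

end Summit.AnomalousDissipation.AnomalousDissipation.Cruxes.GPMeanBoundedFamily.ErgodicSelection

end
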